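import Literature.NumberTheory.LFunctions.WeilCombNodeWeightsDense
import HarnessLib

/-!
# Node weights of `ζ`-mollified combs, III: the sparse regime, the cut window, square roots

Topic `Literature/NumberTheory/LFunctions`.  Companion of
`Literature/NumberTheory/LFunctions/WeilCombNodeWeightsDense.lean` for the tooth sum
`S(c) = ∑_{k ≤ M} k^{-1/2} B((c - log k)/h)`:

* `toothSum_sparse` — SPARSE regime `2h(y+1) < 1`, `c = log(y/ℓ)`: only the exact divisor `k = y/ℓ`
  lies in the window, `S = 𝟙[ℓ ∣ y] B(0)/√(y/ℓ)`;
* `toothSum_eq_zero_of_lt` — the window lies above `M`: `S = 0`;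
* `toothSum_nonneg`, `toothSum_le_main_add` — for `B ≥ 0` and EVERY `M` (window possibly cut),
  `0 ≤ S ≤ h e^{c/2} β_h + C e^{-3c/2}/h`;
* `sqrt_node_mul`, `sq_div_sq_le_mul_sqrt` — square-root bookkeeping for the weights
  `k'^{-1/2} n^{-1/2}` at `x = nℓ'k'/ℓ`.

Everything is proved; no named facts.
-/

noncomputable section

open MeasureTheory Set

namespace Literature.NumberTheory.LFunctions

/-! ## The sparse regime -/

/-- **The tooth sum in the sparse regime.** If `B(x) = 0` for `|x| > 2`, `h > 0`, `y, ℓ ≥ 1`,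
`2h(y + 1) < 1` and `y ≤ K`, then
`∑_{k=1}^{K} B((log(y/ℓ) - log k)/h)/√k = 𝟙[ℓ ∣ y] · B(0)/√(y/ℓ)`:
for `ℓk ≠ y` one has `|log(y/(ℓk))| ≥ 1/(y+1) > 2h`. [folklore] -/
theorem toothSum_sparse {B : ℝ → ℝ} (hBs : ∀ x, 2 < |x| → B x = 0) {h : ℝ} (hh : 0 < h)
    {y ℓ K : ℕ} (hy : 1 ≤ y) (hℓ : 1 ≤ ℓ) (hyh : 2 * h * ((y : ℝ) + 1) < 1) (hK : y ≤ K) :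
    ∑ k ∈ Finset.Icc 1 K, B ((Real.log ((y : ℝ) / ℓ) - Real.log k) / h) / Real.sqrt k
      = if ℓ ∣ y then B 0 / Real.sqrt ((y : ℝ) / ℓ) else 0 := by
  have hyR : (1 : ℝ) ≤ y := by exact_mod_cast hy
  have hℓR : (1 : ℝ) ≤ ℓ := by exact_mod_cast hℓ
  have hy0 : (0 : ℝ) < y := by linarith
  have hℓ0 : (0 : ℝ) < ℓ := by linarith
  -- off the exact divisor the bump vanishes
  have hoff : ∀ k ∈ Finset.Icc 1 K, ℓ * k ≠ y →
      B ((Real.log ((y : ℝ) / ℓ) - Real.log k) / h) / Real.sqrt k = 0 := by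
    intro k hk hne
    have hk1 : 1 ≤ k := (Finset.mem_Icc.1 hk).1
    have hkR : (1 : ℝ) ≤ k := by exact_mod_cast hk1
    have hk0 : (0 : ℝ) < k := by linarith
    have hlk : (0 : ℝ) < ℓ * k := by positivity
    have hlog : Real.log ((y : ℝ) / ℓ) - Real.log k = Real.log ((y : ℝ) / (ℓ * k)) := by
      rw [Real.log_div hy0.ne' hℓ0.ne', Real.log_div hy0.ne' hlk.ne', Real.log_mul hℓ0.ne' hk0.ne']
      ring
    rw [hlog]
    have hB0 : B (Real.log ((y : ℝ) / (ℓ * k)) / h) = 0 := by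
      apply hBs
      rcases Nat.lt_or_gt_of_ne hne with hlt | hgt
      · -- `ℓk ≤ y - 1`: `log(y/(ℓk)) ≥ 1/y > 2h`
        have hle' : ℓ * k + 1 ≤ y := hlt
        have hle : (ℓ : ℝ) * k + 1 ≤ y := by exact_mod_cast hle'
        have h1 : 1 / (y : ℝ) ≤ Real.log ((y : ℝ) / (ℓ * k)) := by
          have := Real.one_sub_inv_le_log_of_pos (x := (y : ℝ) / (ℓ * k)) (by positivity)
          rw [inv_div] at this
          have h2 : 1 / (y : ℝ) ≤ 1 - (ℓ : ℝ) * k / y := by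
            rw [div_le_iff₀ hy0]
            have e : (1 - (ℓ : ℝ) * k / y) * y = y - ℓ * k := by field_simp
            rw [e]; linarith
          linarith
        have h3 : 2 < Real.log ((y : ℝ) / (ℓ * k)) / h := by
          rw [lt_div_iff₀ hh]
          have : 2 * h < 1 / (y : ℝ) := by
            rw [lt_div_iff₀ hy0]; nlinarith
          linarith
        exact lt_of_lt_of_le h3 (le_abs_self _)
      · -- `ℓk ≥ y + 1`: `log(y/(ℓk)) ≤ -1/(y+1) < -2h`
        have hge' : y + 1 ≤ ℓ * k := hgt
        have hge : (y : ℝ) + 1 ≤ ℓ * k := by exact_mod_cast hge'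
        have h1 : 1 / ((y : ℝ) + 1) ≤ Real.log (((ℓ : ℝ) * k) / y) := by
          have := Real.one_sub_inv_le_log_of_pos (x := ((ℓ : ℝ) * k) / y) (by positivity)
          rw [inv_div] at this
          have h2 : 1 / ((y : ℝ) + 1) ≤ 1 - (y : ℝ) / (ℓ * k) := by
            have h21 : (y : ℝ) / (ℓ * k) ≤ y / (y + 1) :=
              div_le_div_of_nonneg_left hy0.le (by positivity) hge
            have e : (y : ℝ) / (y + 1) = 1 - 1 / (y + 1) := by field_simp; ring
            linarith
          linarith
        have hneg : Real.log ((y : ℝ) / (ℓ * k)) = -Real.log (((ℓ : ℝ) * k) / y) := by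
          rw [← Real.log_inv, inv_div]
        have h3 : Real.log ((y : ℝ) / (ℓ * k)) / h < -2 := by
          rw [div_lt_iff₀ hh, hneg]
          have : 2 * h < 1 / ((y : ℝ) + 1) := by
            rw [lt_div_iff₀ (by positivity)]; linarith
          linarith
        have : 2 < -(Real.log ((y : ℝ) / (ℓ * k)) / h) := by linarith
        exact lt_of_lt_of_le this (neg_le_abs _)
    rw [hB0, zero_div]
  split_ifs with hdvd
  · have hk₀ : y / ℓ ∈ Finset.Icc 1 K := by
      rw [Finset.mem_Icc]
      exact ⟨Nat.div_pos (Nat.le_of_dvd hy hdvd) hℓ, (Nat.div_le_self y ℓ).trans hK⟩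
    rw [Finset.sum_eq_single_of_mem (y / ℓ) hk₀]
    · have hcast : ((y / ℓ : ℕ) : ℝ) = (y : ℝ) / ℓ := Nat.cast_div hdvd hℓ0.ne'
      rw [hcast, sub_self, zero_div]
    · intro k hk hne
      apply hoff k hk
      intro heq
      apply hne
      rw [← heq, Nat.mul_div_cancel_left k (by omega)]
  · apply Finset.sum_eq_zero
    intro k hk
    apply hoff k hk
    intro heq
    exact hdvd ⟨k, heq.symm⟩

/-! ## Beyond the edge: the window lies above `M` -/

/-- If `M < e^{c - 2h}` the whole window of the tooth sum lies above `M` and the sum vanishes.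
[folklore] -/
theorem toothSum_eq_zero_of_lt {B : ℝ → ℝ} (hBs : ∀ x, 2 < |x| → B x = 0) {h c : ℝ} (hh : 0 < h)
    {M : ℕ} (hM : (M : ℝ) < Real.exp (c - 2 * h)) :
    ∑ k ∈ Finset.Icc 1 M, B ((c - Real.log k) / h) / Real.sqrt k = 0 := by
  refine Finset.sum_eq_zero fun k hk ↦ ?_
  have hk1 : 1 ≤ k := (Finset.mem_Icc.1 hk).1
  have hkM : k ≤ M := (Finset.mem_Icc.1 hk).2
  have hk0 : (0 : ℝ) < k := by exact_mod_cast hk1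
  have hkM' : (k : ℝ) < Real.exp (c - 2 * h) := lt_of_le_of_lt (by exact_mod_cast hkM) hM
  have hlog : Real.log k < c - 2 * h := by
    rw [← Real.exp_lt_exp, Real.exp_log hk0]; exact hkM'
  have : 2 < (c - Real.log k) / h := by rw [lt_div_iff₀ hh]; linarith
  rw [hBs _ (lt_of_lt_of_le this (le_abs_self _)), zero_div]

/-! ## The tooth sum cut by `k ≤ M` from above (`B ≥ 0`) -/

/-- The tooth sum is nonnegative when `B ≥ 0`. [folklore] -/
theorem toothSum_nonneg {B : ℝ → ℝ} (hB0 : ∀ x, 0 ≤ B x) (h c : ℝ) (M : ℕ) :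
    0 ≤ ∑ k ∈ Finset.Icc 1 M, B ((c - Real.log k) / h) / Real.sqrt k :=
  Finset.sum_nonneg fun _ _ ↦ div_nonneg (hB0 _) (Real.sqrt_nonneg _)

/-- **Upper bound for a possibly cut tooth sum** (`B ≥ 0`): for EVERY `M`, under the hypotheses of
`abs_toothSum_sub_main_le` except `e^{c+2h} ≤ M`,
`∑_{k ≤ M} B((c - log k)/h)/√k ≤ h e^{c/2} β_h + (N₀+2N₁+N₂)(96+48/c₀) e^{-3c/2}/h`. [folklore] -/
theorem toothSum_le_main_add {B B' B'' : ℝ → ℝ} {N₀ N₁ N₂ c₀ h c : ℝ}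
    (hB : ∀ x, HasDerivAt B (B' x) x) (hB' : ∀ x, HasDerivAt B' (B'' x) x)
    (h0 : ∀ x, |B x| ≤ N₀) (h1 : ∀ x, |B' x| ≤ N₁) (h2 : ∀ x, |B'' x| ≤ N₂)
    (hBs : ∀ x, 2 < |x| → B x = 0) (hB0 : ∀ x, 0 ≤ B x)
    (hh : 0 < h) (hh4 : h ≤ 1 / 4) (hc₀ : 0 < c₀) (hc₀h : c₀ ≤ h * Real.exp c)
    (hc4 : 4 ≤ Real.exp (c - 2 * h)) (M : ℕ) :
    ∑ k ∈ Finset.Icc 1 M, B ((c - Real.log k) / h) / Real.sqrt k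
      ≤ h * Real.exp (c / 2) * (∫ v, B v * Real.exp (-(h * v) / 2))
        + (N₀ + 2 * N₁ + N₂) * (96 + 48 / c₀) * Real.exp (-(3 * c / 2)) / h := by
  set K : ℕ := max M ⌈Real.exp (c + 2 * h)⌉₊ with hK
  have hKexp : Real.exp (c + 2 * h) ≤ K := by
    rw [hK]; push_cast
    exact (Nat.le_ceil _).trans (le_max_right _ _)
  have hmono : ∑ k ∈ Finset.Icc 1 M, B ((c - Real.log k) / h) / Real.sqrt k
      ≤ ∑ k ∈ Finset.Icc 1 K, B ((c - Real.log k) / h) / Real.sqrt k := by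
    apply Finset.sum_le_sum_of_subset_of_nonneg
    · exact Finset.Icc_subset_Icc le_rfl (le_max_left _ _)
    · intro k _ _
      exact div_nonneg (hB0 _) (Real.sqrt_nonneg _)
  have hd := abs_toothSum_sub_main_le hB hB' h0 h1 h2 hBs hh hh4 hc₀ hc₀h hc4 hKexp
  have := (le_abs_self _).trans hd
  linarith

/-! ## The four ranges of one term `k'^{-1/2} n^{-1/2} S(log(nℓ'k'/ℓ))` -/

/-- Square roots bookkeeping: for `x = nℓ'k'/ℓ`, `√x · √k' · √n = n k' √ℓ'/√ℓ`. [folklore] -/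
theorem sqrt_node_mul {n ℓ ℓ' k' : ℕ} (hℓ : 1 ≤ ℓ) :
    Real.sqrt ((n : ℝ) * ℓ' * k' / ℓ) * Real.sqrt k' * Real.sqrt n
      = n * k' * (Real.sqrt ℓ' / Real.sqrt ℓ) := by
  have hℓ0 : (0 : ℝ) < ℓ := by exact_mod_cast hℓ
  have hn : (0 : ℝ) ≤ n := Nat.cast_nonneg n
  have hk : (0 : ℝ) ≤ k' := Nat.cast_nonneg k'
  have hl' : (0 : ℝ) ≤ ℓ' := Nat.cast_nonneg ℓ'
  rw [Real.sqrt_div' _ hℓ0.le, Real.sqrt_mul (by positivity), Real.sqrt_mul hn]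
  have e1 : Real.sqrt (k' : ℝ) * Real.sqrt k' = k' := Real.mul_self_sqrt hk
  have e2 : Real.sqrt (n : ℝ) * Real.sqrt n = n := Real.mul_self_sqrt hn
  calc Real.sqrt (n : ℝ) * Real.sqrt ℓ' * Real.sqrt k' / Real.sqrt ℓ * Real.sqrt k' * Real.sqrt n
      = (Real.sqrt (n : ℝ) * Real.sqrt n) * (Real.sqrt (k' : ℝ) * Real.sqrt k') *
          (Real.sqrt ℓ' / Real.sqrt ℓ) := by ring
    _ = n * k' * (Real.sqrt ℓ' / Real.sqrt ℓ) := by rw [e1, e2]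

/-- The weight bound of the dense ranges: if `x ≥ q/L > 0` with `L ≥ 1` then
`q² / L² ≤ x √x √q`. [folklore] -/
theorem sq_div_sq_le_mul_sqrt {x q L : ℝ} (hL : 1 ≤ L) (hq : 0 < q) (hx : q / L ≤ x) :
    q ^ 2 / L ^ 2 ≤ x * Real.sqrt x * Real.sqrt q := by
  have hL0 : 0 < L := by linarith
  have hqL : 0 < q / L := by positivity
  have hx0 : 0 < x := hqL.trans_le hx
  have hsq : Real.sqrt (q / L) ≤ Real.sqrt x := Real.sqrt_le_sqrt hx
  have hsL : Real.sqrt L ≤ L := by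
    rw [Real.sqrt_le_left (by linarith)]
    nlinarith
  have hsL0 : 0 < Real.sqrt L := Real.sqrt_pos.2 hL0
  -- `x √x √q ≥ (q/L) √(q/L) √q = (q/L) q / √L ≥ q² / L²`
  have h1 : q / L * Real.sqrt (q / L) * Real.sqrt q ≤ x * Real.sqrt x * Real.sqrt q := by
    have := mul_le_mul hx hsq (Real.sqrt_nonneg _) hx0.le
    exact mul_le_mul_of_nonneg_right this (Real.sqrt_nonneg _)
  have h2 : q / L * Real.sqrt (q / L) * Real.sqrt q = q ^ 2 / (L * Real.sqrt L) := by
    have e : Real.sqrt q * Real.sqrt q = q := Real.mul_self_sqrt hq.le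
    rw [Real.sqrt_div' _ hL0.le, div_mul_div_comm, div_mul_eq_mul_div, mul_assoc, e, sq]
  have h3 : q ^ 2 / L ^ 2 ≤ q ^ 2 / (L * Real.sqrt L) := by
    apply div_le_div_of_nonneg_left (by positivity) (by positivity)
    rw [sq]
    exact mul_le_mul_of_nonneg_left hsL hL0.le
  linarith [h1, h2, h3]

end Literature.NumberTheory.LFunctions
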